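import Mathlib

/-!
# T6ExteriorDuality — the top-degree pairing of a finite exterior algebra is perfect

Carrier-free. For a field `F`, a finite-dimensional `M` with a basis `b : Basis I F M` (`I` finite,
linearly ordered), `topCoeff b : ExteriorAlgebra F M →ₗ[F] F` is the coordinate of the top monomial
`e_univ = ⋀_{i ∈ I} b i` in Mathlib's monomial basis `b.ExteriorAlgebra : Basis (Finset I) F (⋀ M)`.
`exists_topCoeff_mul_ne_zero`: every `p ≠ 0` has a monomial `u = e_{sᶜ}` with `topCoeff (p * u) ≠ 0`
(Poincaré duality for the exterior algebra: the pairing `(p, u) ↦ topCoeff (p * u)` is non-degenerate),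
and `pairingEquiv` is the resulting isomorphism `⋀ M ≃ₗ[F] Module.Dual F (⋀ M)`.
Used by the lead's toy instance of `TransferShadow` (README §10.5(ii)(c),(d) witness for M1).
§8(d): uses an L-value-free non-vanishing device: NO.
-/

namespace Summit.Ventures.HodgeRepro2.T6.ExteriorDuality

open ExteriorAlgebra Set Set.powersetCard

variable {F : Type*} [Field F] {M : Type*} [AddCommGroup M] [Module F M]
variable {I : Type*} [Fintype I] [LinearOrder I] (b : Module.Basis I F M)

/-- The top coordinate: the coefficient of the top monomial `e_univ` in the monomial basis. -/
noncomputable def topCoeff : ExteriorAlgebra F M →ₗ[F] F :=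
  b.ExteriorAlgebra.coord Finset.univ

/-- `topCoeff` on a monomial: `1` on `e_univ`, `0` on every other monomial. -/
lemma topCoeff_basis (s : Finset I) :
    topCoeff b (b.ExteriorAlgebra s) = if s = Finset.univ then 1 else 0 := by
  simp [topCoeff, Module.Basis.coord_apply, Module.Basis.repr_self, Finsupp.single_apply]

omit [Fintype I] in
/-- Monomials with a common index multiply to zero. -/
lemma basis_mul_basis_of_not_disjoint {t u : Finset I} (h : ¬ Disjoint t u) :
    b.ExteriorAlgebra t * b.ExteriorAlgebra u = 0 :=
  basis_mul_of_not_disjoint b (ofCard (rfl : t.card = t.card)) (ofCard (rfl : u.card = u.card)) h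

omit [Fintype I] in
/-- Monomials with disjoint index sets multiply to `±` the monomial of the union. -/
lemma basis_mul_basis_of_disjoint {t u : Finset I} (h : Disjoint t u) :
    b.ExteriorAlgebra t * b.ExteriorAlgebra u =
      (permOfDisjoint (s := ofCard (rfl : t.card = t.card)) (t := ofCard (rfl : u.card = u.card)) h).sign •
        b.ExteriorAlgebra (t.disjUnion u h) :=
  basis_mul_of_disjoint b (ofCard (rfl : t.card = t.card)) (ofCard (rfl : u.card = u.card)) h

/-- A unit sign acting on `1 ∈ F` is non-zero. -/
lemma units_zsmul_one_ne_zero (ε : ℤˣ) : ((ε : ℤ) • (1 : F)) ≠ 0 := by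
  rcases Int.units_eq_one_or ε with h | h <;> simp [h]

/-- `topCoeff (e_t * e_{sᶜ}) = 0` unless `t = s`. -/
lemma topCoeff_basis_mul_basis_compl_of_ne {s t : Finset I} (hts : t ≠ s) :
    topCoeff b (b.ExteriorAlgebra t * b.ExteriorAlgebra sᶜ) = 0 := by
  classical
  by_cases h : Disjoint t sᶜ
  · rw [basis_mul_basis_of_disjoint b h, Units.smul_def, map_zsmul, topCoeff_basis]
    have hsub : t ⊆ s := fun i hi => by simpa using Finset.disjoint_left.mp h hi
    have hts' : t.disjUnion sᶜ h ≠ Finset.univ := by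
      intro huniv
      apply hts
      refine le_antisymm hsub ?_
      intro i hi
      have := Finset.mem_univ i
      rw [← huniv, Finset.mem_disjUnion] at this
      rcases this with h1 | h1
      · exact h1
      · exact absurd hi (Finset.mem_compl.mp h1)
    rw [if_neg hts', smul_zero]
  · rw [basis_mul_basis_of_not_disjoint b h, map_zero]

/-- `topCoeff (e_s * e_{sᶜ}) = ±1 ≠ 0`. -/
lemma topCoeff_basis_mul_basis_compl_ne_zero (s : Finset I) :
    topCoeff b (b.ExteriorAlgebra s * b.ExteriorAlgebra sᶜ) ≠ 0 := by
  classical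
  have h : Disjoint s sᶜ := disjoint_compl_right
  rw [basis_mul_basis_of_disjoint b h, Units.smul_def, map_zsmul, topCoeff_basis]
  have : s.disjUnion sᶜ h = Finset.univ := by
    ext i; simp
  rw [if_pos this]
  exact units_zsmul_one_ne_zero _

/-- PERFECTNESS: every non-zero `p` pairs non-trivially with some monomial `e_{sᶜ}`. -/
theorem exists_topCoeff_mul_ne_zero (p : ExteriorAlgebra F M) (hp : p ≠ 0) :
    ∃ s : Finset I, topCoeff b (p * b.ExteriorAlgebra sᶜ) ≠ 0 := by
  classical
  set B := b.ExteriorAlgebra with hB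
  have hrepr : B.repr p ≠ 0 := fun h => hp ((LinearEquiv.map_eq_zero_iff B.repr).mp h)
  obtain ⟨s, hs⟩ : ∃ s, B.repr p s ≠ 0 := by
    by_contra! h
    exact hrepr (Finsupp.ext h)
  refine ⟨s, ?_⟩
  have hexp : p = ∑ t : Finset I, B.repr p t • B t := (B.sum_repr p).symm
  rw [hexp, Finset.sum_mul, map_sum, Finset.sum_eq_single s]
  · rw [smul_mul_assoc, LinearMap.map_smul, smul_eq_mul]
    exact mul_ne_zero hs (topCoeff_basis_mul_basis_compl_ne_zero b s)
  · intro t _ hts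
    rw [smul_mul_assoc, LinearMap.map_smul, topCoeff_basis_mul_basis_compl_of_ne b hts, smul_zero]
  · intro h; exact absurd (Finset.mem_univ s) h


/-- `topCoeff` kills every homogeneous element of degree `i ≠ dim M`. -/
lemma topCoeff_of_mem_of_ne {i : ℕ} (hi : i ≠ Fintype.card I) {u : ExteriorAlgebra F M}
    (hu : u ∈ ⋀[F]^i M) : topCoeff b u = 0 := by
  classical
  set B := b.exteriorPower i with hB
  have hexp : (⟨u, hu⟩ : ⋀[F]^i M) = ∑ s, B.repr ⟨u, hu⟩ s • B s := (B.sum_repr _).symm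
  have hexp' : u = ∑ s, B.repr ⟨u, hu⟩ s • (B s : ExteriorAlgebra F M) := by
    have := congrArg Subtype.val hexp
    rw [Submodule.coe_sum] at this
    simpa only [Submodule.coe_smul] using this
  rw [hexp', map_sum]
  refine Finset.sum_eq_zero fun s _ => ?_
  rw [LinearMap.map_smul, hB, ← basis_eq_coe_basis, topCoeff_basis]
  have hs : (s : Finset I) ≠ Finset.univ := by
    intro h
    apply hi
    rw [← card_eq s, h, Finset.card_univ]
  rw [if_neg hs, smul_zero]

omit [Fintype I] in
/-- The monomial `e_s` is homogeneous of degree `s.card`. -/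
lemma basis_mem (s : Finset I) : b.ExteriorAlgebra s ∈ ⋀[F]^(s.card) M := by
  rw [basis_apply_ofCard b (rfl : s.card = s.card), ← exteriorPower.ιMulti_family_apply_coe]
  exact SetLike.coe_mem _

/-- The pairing map `p ↦ (u ↦ topCoeff (p * u))`. -/
noncomputable def pairingMap : ExteriorAlgebra F M →ₗ[F] Module.Dual F (ExteriorAlgebra F M) :=
  (LinearMap.mul F (ExteriorAlgebra F M)).compr₂ (topCoeff b)

/-- `pairingMap b p u = topCoeff b (p * u)`. -/
@[simp] lemma pairingMap_apply (p u : ExteriorAlgebra F M) :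
    pairingMap b p u = topCoeff b (p * u) := rfl

/-- The pairing map is injective (perfectness, left kernel). -/
lemma pairingMap_injective : Function.Injective (pairingMap b) := by
  rw [← LinearMap.ker_eq_bot, LinearMap.ker_eq_bot']
  intro p hp
  by_contra hne
  obtain ⟨s, hs⟩ := exists_topCoeff_mul_ne_zero b p hne
  exact hs (by simpa using congrArg (fun φ => φ (b.ExteriorAlgebra sᶜ)) hp)

/-- The pairing map is bijective (injective + equal finite dimensions). -/
lemma pairingMap_bijective : Function.Bijective (pairingMap b) := by
  have hfin : Module.Finite F (ExteriorAlgebra F M) := Module.Finite.of_basis b.ExteriorAlgebra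
  refine ⟨pairingMap_injective b, ?_⟩
  exact (LinearMap.injective_iff_surjective_of_finrank_eq_finrank
    (Subspace.dual_finrank_eq).symm).mp (pairingMap_injective b)

/-- POINCARÉ DUALITY for the exterior algebra of a finite-dimensional space. -/
noncomputable def pairingEquiv : ExteriorAlgebra F M ≃ₗ[F] Module.Dual F (ExteriorAlgebra F M) :=
  LinearEquiv.ofBijective (pairingMap b) (pairingMap_bijective b)

/-- `pairingEquiv b p u = topCoeff b (p * u)`. -/
@[simp] lemma pairingEquiv_apply (p u : ExteriorAlgebra F M) :
    pairingEquiv b p u = topCoeff b (p * u) := rfl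

/-- The inverse of `pairingEquiv` represents a functional: `topCoeff ((pairingEquiv b).symm φ * u) = φ u`. -/
@[simp] lemma topCoeff_pairingEquiv_symm_mul (φ : Module.Dual F (ExteriorAlgebra F M))
    (u : ExteriorAlgebra F M) : topCoeff b ((pairingEquiv b).symm φ * u) = φ u :=
  congrArg (fun ψ : Module.Dual F (ExteriorAlgebra F M) => ψ u) ((pairingEquiv b).apply_symm_apply φ)

end Summit.Ventures.HodgeRepro2.T6.ExteriorDuality
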